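import Literature.AlgebraicGeometry.Hironaka2017.S02Preliminaries.R002LSB
import Literature.AlgebraicGeometry.Hironaka2017.S03DiffARNE.R026aInducedLSB
import Literature.AlgebraicGeometry.Hironaka2017.S03DiffARNE.R027aAREquiv
import HarnessLib

/-!
# KILL TEST K3.4 (cell res-hironaka, LADDER-RESOLUTION rung L, slot W3.4 «class-local renewal», L-G3 datum Ě) —
# file F1: 𝔖-membership of a FIXED LSB is a CLASS property (transport along `SEq`, `AREquiv`, `IsAmbientReduction`)

[OURS · L1 W3.4 / kill test K3.4] — replaces the role of NO printed item; NOT a statement of the manuscript. Everything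
here is elementary logic over the typed CANDIDATE DEFINITIONS of the statements-first typing of H. Hironaka's manuscript
*Resolution of singularities in positive characteristics* (2017-03-23) [claim: Hironaka2017, status: under-review]:
`S02Preliminaries.InS` / `SIncl` / `SEq` (Def. 2.5 `𝔖(E)`, Eq. (35) `∼`, file `R002LSB`), `S03DiffARNE.LSBInduces` /
`LSBCentresIn` / `IsAmbientReduction` (Th. 3.10 «ambient reduction in the following sense», `⇁_Y`, file `R026aInducedLSB`)
and `S03DiffARNE.AREquiv` = Eq. (14) / Def. 3.12 (AR-equivalence `⇌_Y`, file `R027aAREquiv`). No typed candidate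
PROPOSITION is assumed; only DEFINITIONS are unfolded, so nothing below is conditional and nothing asserts any claim of
the manuscript. AI review is weaker than expert review.

## What the kill test asks and what this file supplies

RESCUE-SEED L-G3 W3.4 (res-plan-2): «does AxisEscape's witness escape the AR-equivalence class or only the literal
exponent?» The prior index (`Literature.AlgebraicGeometry.Hironaka2017.AxisEscape`, folklore exponent bookkeeping) shows
that at `Ê = (y² − x²z² + x⁵, 2)`, char `≥ 3`, the tower `s_m = [O; R₁; …; R_m]` of z-chart origins is `Ê`-permissible
for every `m` while every LITERAL pair `(A, b)` whose singular locus omits the generic point of the z-axis loses the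
tower after finitely many steps. An «escape» is the statement `s_m ∉ 𝔖(P)` for ONE FIXED LSB `s_m`. This file records,
over OUR decls, that such a statement is never a property of a representative:

* `inS_iff_of_sEq` — `SEq E₁ E₂ → (InS E₁ t A ↔ InS E₂ t A)`: invariant on the `∼`-class (Eq. (35));
* `inS_of_arEquiv_of_induces` — `AREquiv F Y G → LSBInduces _ A B → InS G t B → InS F t A`: persistence along an
  induced LSB CLIMBS from every AR-partner `G` on `Y` to `F`;
* `not_inS_induced_of_arEquiv` — `AREquiv F Y G → ¬ InS F t A → LSBInduces _ A B → ¬ InS G t B`: an escape from `F`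
  DESCENDS to every LSB it induces on `Y`, for every AR-partner `G`;
* `not_inS_of_arEquiv_of_forall_induced`, `lsbCentresIn_of_arEquiv` (a permissible LSB of `F` has all centres in the
  strict transforms of `Y`), `inS_iff_of_isAmbientReduction` (the `⇁_Y` version, Th. 3.10's relation);
* `LSBInduces.unique` — the induced LSB is unique (the typed recursion pins every centre down by its vanishing ideal),
  whence the sharp form `inS_iff_of_arEquiv : AREquiv F Y G → LSBInduces _ A B → (InS F t A ↔ InS G t B)`: along the
  induced tower an AR-equivalence transports 𝔖-membership EXACTLY, so the escape STEP is the same for `F` and `G`.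

Consequence used in HOME/L/res-L1-k34/KILL-TEST-K3.4.md (with file F2, the combinatorial escape in every ambient
dimension): a renewal that re-focuses INSIDE the `∼`-class of the old focus, or passes to an AR-partner (`⇌_Y`, `⇁_Y`,
natural AR-extension of Lem. 3.14 / Lem. 15.3), inherits every escape of the old focus — the AxisEscape witness escapes
the whole AR- or LSB-equivalence class, not only the literal exponent.

## References
* H. Hironaka, ms. 2017-03-23 — Def. 2.4/2.5, Rem. 2.6 p.6; Th. 3.10 p.10; Eq. (12)–(14), Def. 3.11/3.12 p.11; Lem. 3.14
  p.12; Lem. 15.3 p.75; §16.3 p.87 l.13–24 (quoted for scope only; ADJUDICATED, never a premise). [Hironaka2017]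
* cell res-hironaka: plan/RESCUE-SEED.md §1 L-G3 W3.4; ledger/group-3/DOSSIER.md §1 R19, §2 R19a; L/res-L1-k34/PREREG-K3.4.md.
-/

noncomputable section

open CategoryTheory TopologicalSpace
open _root_.AlgebraicGeometry

namespace Summit.ResolutionOfSingularities.ResolutionOfSingularities.Theorems.CampaignW34

set_option linter.dupNamespace false -- mandated namespace of this single-conjunct summit

open Literature.AlgebraicGeometry.Resolution AlgebraicGeometry.Scheme.IdealSheafData
open Literature.AlgebraicGeometry.Hironaka2017.S02Preliminaries
open Literature.AlgebraicGeometry.Hironaka2017.S03DiffARNE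

universe u

/-! ## `∼`-classes (Eq. (35)): 𝔖-membership of a fixed LSB is invariant -/

section SEqTransport

variable {Z : Scheme.{u}} {E₁ E₂ : IdealExponent Z}

/-- [OURS · K3.4] `𝔖(E₁) ⊃ 𝔖(E₂)` transports membership of every FIXED LSB `A` over `Z[t]` (definitional unfolding of
the typed `SIncl`, Def. 2.5 / Th. 3.1 usage). -/
theorem inS_of_sIncl (h : SIncl E₁ E₂) {t : Type u} {A : LSB 𝔸(t; Z)} (hA : InS E₂ t A) : InS E₁ t A :=
  h t A hA

/-- [OURS · K3.4] On a `∼`-class (`SEq`, Eq. (35) p.25: `𝔖(E₁) = 𝔖(E₂)`) membership of every FIXED LSB `A` over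
`Z[t]` in `𝔖(·)` is an invariant: `A ∈ 𝔖(E₁) ↔ A ∈ 𝔖(E₂)`. In particular «the tower `s_m` is permissible» and its
negation «`s_m` escapes» are predicates on the class, never on the representative. -/
theorem inS_iff_of_sEq (h : SEq E₁ E₂) {t : Type u} (A : LSB 𝔸(t; Z)) : InS E₁ t A ↔ InS E₂ t A :=
  ⟨fun hA => h.2 t A hA, fun hA => h.1 t A hA⟩

/-- [OURS · K3.4] Escape is `∼`-invariant: if the fixed LSB `A` is not in `𝔖(E₁)` then it is not in `𝔖(E₂)` for any
`E₂ ∼ E₁`. -/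
theorem not_inS_of_sEq (h : SEq E₁ E₂) {t : Type u} {A : LSB 𝔸(t; Z)} (hA : ¬ InS E₁ t A) : ¬ InS E₂ t A :=
  fun h₂ => hA ((inS_iff_of_sEq h A).2 h₂)

/-- [OURS · K3.4] `SEq` is symmetric (bookkeeping). -/
theorem sEq_symm (h : SEq E₁ E₂) : SEq E₂ E₁ := ⟨h.2, h.1⟩

/-- [OURS · K3.4] `SEq` is reflexive (bookkeeping). -/
theorem sEq_refl (E : IdealExponent Z) : SEq E E := ⟨fun _ _ h => h, fun _ _ h => h⟩

/-- [OURS · K3.4] `SEq` is transitive (bookkeeping). -/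
theorem sEq_trans {E₃ : IdealExponent Z} (h₁₂ : SEq E₁ E₂) (h₂₃ : SEq E₂ E₃) : SEq E₁ E₃ :=
  ⟨fun t A h => h₁₂.1 t A (h₂₃.1 t A h), fun t A h => h₂₃.2 t A (h₁₂.2 t A h)⟩

end SEqTransport

/-! ## AR-classes (Eq. (14) / Def. 3.12 `⇌_Y`, Th. 3.10 `⇁_Y`): transport along the induced LSB -/

section ARTransport

variable {Z : Scheme.{u}} {F : IdealExponent Z} {Y : Closeds Z}
  {G : IdealExponent (vanishingIdeal Y).subscheme}

/-- [OURS · K3.4] PERSISTENCE CLIMBS. If `F ⇌_Y G` (typed `AREquiv`, Def. 3.12) and the LSB `A` over `Z[t]` induces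
`B` over `Y[t]`, then `B ∈ 𝔖(G)` implies `A ∈ 𝔖(F)`. -/
theorem inS_of_arEquiv_of_induces (h : AREquiv F Y G) {t : Type u} {A : LSB 𝔸(t; Z)}
    {B : LSB 𝔸(t; (vanishingIdeal Y).subscheme)}
    (hAB : LSBInduces (AffineSpace.map t (vanishingIdeal Y).subschemeι) A B) (hB : InS G t B) : InS F t A :=
  (h t A).2 ⟨B, hAB, hB⟩

/-- [OURS · K3.4] ESCAPE DESCENDS. If `F ⇌_Y G` and the fixed LSB `A` over `Z[t]` is NOT in `𝔖(F)`, then no LSB `B`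
that `A` induces on `Y[t]` lies in `𝔖(G)`: an escape from `F` is an escape from every AR-partner `G` along the induced
sequence. -/
theorem not_inS_induced_of_arEquiv (h : AREquiv F Y G) {t : Type u} {A : LSB 𝔸(t; Z)} (hA : ¬ InS F t A)
    {B : LSB 𝔸(t; (vanishingIdeal Y).subscheme)}
    (hAB : LSBInduces (AffineSpace.map t (vanishingIdeal Y).subschemeι) A B) : ¬ InS G t B :=
  fun hB => hA (inS_of_arEquiv_of_induces h hAB hB)

/-- [OURS · K3.4] Conversely, if every LSB induced by `A` on `Y[t]` escapes `G`, then `A` escapes `F`. -/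
theorem not_inS_of_arEquiv_of_forall_induced (h : AREquiv F Y G) {t : Type u} {A : LSB 𝔸(t; Z)}
    (hall : ∀ B : LSB 𝔸(t; (vanishingIdeal Y).subscheme),
      LSBInduces (AffineSpace.map t (vanishingIdeal Y).subschemeι) A B → ¬ InS G t B) :
    ¬ InS F t A :=
  fun hA => by
    obtain ⟨B, hAB, hB⟩ := (h t A).1 hA
    exact hall B hAB hB

/-- [OURS · K3.4] Under `F ⇌_Y G`, every LSB in `𝔖(F)` has all its centres in the strict transforms of `Y[t]`
(typed `LSBCentresIn`): the singular loci of `F` and of all its transforms along permissible sequences stay on `Y`. -/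
theorem lsbCentresIn_of_arEquiv (h : AREquiv F Y G) {t : Type u} {A : LSB 𝔸(t; Z)} (hA : InS F t A) :
    LSBCentresIn (AffineSpace.map t (vanishingIdeal Y).subschemeι) A := by
  obtain ⟨B, hAB, -⟩ := (h t A).1 hA
  exact ⟨B, hAB⟩

/-- [OURS · K3.4] The `⇁_Y` version (Th. 3.10 «ambient reduction in the following sense», typed `IsAmbientReduction`):
along an induced pair `(A, B)` membership is transported EXACTLY, `A ∈ 𝔖(F) ↔ B ∈ 𝔖(G)`. -/
theorem inS_iff_of_isAmbientReduction (h : IsAmbientReduction F Y G) {t : Type u} {A : LSB 𝔸(t; Z)}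
    {B : LSB 𝔸(t; (vanishingIdeal Y).subscheme)}
    (hAB : LSBInduces (AffineSpace.map t (vanishingIdeal Y).subschemeι) A B) : InS F t A ↔ InS G t B :=
  h t A B hAB

end ARTransport

/-! ## The induced LSB is unique, hence `⇌_Y` transports membership exactly along induced pairs -/

section Unique

/-- [OURS · K3.4] Unfolding of the typed `LSBInduces` on the empty LSB (holds by `rfl` from the recursor form of
`R026aInducedLSB`). -/
theorem lsbInduces_nil_iff {Z Y : Scheme.{u}} (i : Y ⟶ Z) (B : LSB Y) :
    LSBInduces i (LSB.nil Z) B ↔ B = LSB.nil Y := Iff.rfl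

/-- [OURS · K3.4] Unfolding of the typed `LSBInduces` on a step `(U, D, rest)` (holds by `rfl`): the induced LSB is
`(i⁻¹U, D′, rest′)` with `𝓘_{D′} = 𝓘_D · 𝒪_{Y ∩ U}`, `D` inside the image of `Y`, and `rest` inducing `rest′` along the
strict-transform morphism. -/
theorem lsbInduces_cons_iff {Z Y : Scheme.{u}} (i : Y ⟶ Z) (U : Z.Opens) (D : Closeds (U : Scheme.{u}))
    (rest : LSB (blowup (vanishingIdeal D))) (B : LSB Y) :
    LSBInduces i (LSB.cons U D rest) B ↔
      ∃ (D' : Closeds ((i ⁻¹ᵁ U : _) : Scheme.{u}))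
        (_ : vanishingIdeal D' = (vanishingIdeal D).comap (i ∣_ U))
        (hρ : IsBlowup (blowup.π (vanishingIdeal D')) ((vanishingIdeal D).comap (i ∣_ U)))
        (rest' : LSB (blowup (vanishingIdeal D'))),
        (D : Set (U : Scheme.{u})) ⊆ Set.range (i ∣_ U) ∧
        B = LSB.cons (i ⁻¹ᵁ U) D' rest' ∧
        LSBInduces ((blowup.isBlowup (vanishingIdeal D)).strictTransformHom hρ) rest rest' :=
  Iff.rfl

/-- [OURS · K3.4] A closed subset is determined by its vanishing ideal sheaf (Mathlib: the support of
`vanishingIdeal D` is `D`). [folklore] -/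
theorem closeds_eq_of_vanishingIdeal_eq {X : Scheme.{u}} {D₁ D₂ : Closeds X}
    (h : vanishingIdeal D₁ = vanishingIdeal D₂) : D₁ = D₂ := by
  apply SetLike.coe_injective
  rw [← coe_support_vanishingIdeal D₁, ← coe_support_vanishingIdeal D₂, h]

/-- [OURS · K3.4] UNIQUENESS of the induced LSB: the typed recursion `LSBInduces` determines `B` from `A` (each centre
`D′` is fixed by `𝓘_{D′} = 𝓘_D·𝒪_{Y∩U}`, each stage by the previous one). [folklore] -/
theorem LSBInduces.unique : ∀ {Z : Scheme.{u}} (A : LSB Z) {Y : Scheme.{u}} (i : Y ⟶ Z) {B B' : LSB Y},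
    LSBInduces i A B → LSBInduces i A B' → B = B'
  | _, LSB.nil Z, Y, i, B, B', h, h' => by
    rw [lsbInduces_nil_iff] at h h'
    rw [h, h']
  | _, LSB.cons U D rest, Y, i, B, B', h, h' => by
    obtain ⟨D₁, hD₁, hρ₁, rest₁, -, rfl, hind₁⟩ := h
    obtain ⟨D₂, hD₂, hρ₂, rest₂, -, rfl, hind₂⟩ := h'
    obtain rfl : D₁ = D₂ := closeds_eq_of_vanishingIdeal_eq (hD₁.trans hD₂.symm)
    obtain rfl : rest₁ = rest₂ := LSBInduces.unique rest _ hind₁ hind₂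
    rfl

variable {Z : Scheme.{u}} {F : IdealExponent Z} {Y : Closeds Z}
  {G : IdealExponent (vanishingIdeal Y).subscheme}

/-- [OURS · K3.4] EXACT TRANSPORT for `⇌_Y`: if `F ⇌_Y G` and `A` induces `B`, then `A ∈ 𝔖(F) ↔ B ∈ 𝔖(G)`. Hence,
along the tower induced on `Y` by the AxisEscape tower, the escape step of every AR-partner `G` equals that of `F`. -/
theorem inS_iff_of_arEquiv (h : AREquiv F Y G) {t : Type u} {A : LSB 𝔸(t; Z)}
    {B : LSB 𝔸(t; (vanishingIdeal Y).subscheme)}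
    (hAB : LSBInduces (AffineSpace.map t (vanishingIdeal Y).subschemeι) A B) : InS F t A ↔ InS G t B := by
  refine ⟨fun hA => ?_, inS_of_arEquiv_of_induces h hAB⟩
  obtain ⟨B', hAB', hB'⟩ := (h t A).1 hA
  rwa [LSBInduces.unique A _ hAB hAB']

/-- [OURS · K3.4] An AR-equivalence restricted to induced pairs IS an ambient reduction in the sense of Th. 3.10
(typed `IsAmbientReduction`), by uniqueness of the induced LSB. -/
theorem isAmbientReduction_of_arEquiv (h : AREquiv F Y G) : IsAmbientReduction F Y G :=
  fun _ _ _ hAB => inS_iff_of_arEquiv h hAB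

end Unique

/-! ## Class-local re-focusing inherits escapes (the W3.4 lever, stated over OUR decls) -/

section Renewal

variable {Z : Scheme.{u}}

/-- [OURS · K3.4] CLASS-LOCAL RENEWAL ON `Z` INHERITS ESCAPES. Let `P` be any ideal exponent on `Z` (the old focus, or
its transform) and `A` a fixed LSB over `Z[t]` with `A ∉ 𝔖(P)` (the escaped tower). Then every `P′ ∼ P` — i.e. every
re-focusing inside the `∼`-class — has `A ∉ 𝔖(P′)`; and for every smooth `Y` and every AR-partner `G` of `P` on `Y`
(`P ⇌_Y G`, e.g. `G` an ambient reduction with `P` its natural AR-extension, Lem. 3.14 / Lem. 15.3 shape) every LSB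
that `A` induces on `Y[t]` has `B ∉ 𝔖(G)`. So «re-focusing within AR- or LSB-equivalence classes» can never recapture a
point lost by the literal representative. -/
theorem classLocal_refocus_inherits_escape (P : IdealExponent Z) {t : Type u} {A : LSB 𝔸(t; Z)}
    (hA : ¬ InS P t A) :
    (∀ P' : IdealExponent Z, SEq P P' → ¬ InS P' t A) ∧
    (∀ (Y : Closeds Z) (G : IdealExponent (vanishingIdeal Y).subscheme), AREquiv P Y G →
      ∀ B : LSB 𝔸(t; (vanishingIdeal Y).subscheme),
        LSBInduces (AffineSpace.map t (vanishingIdeal Y).subschemeι) A B → ¬ InS G t B) :=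
  ⟨fun _ hP' => not_inS_of_sEq hP' hA, fun _ _ hG _ hAB => not_inS_induced_of_arEquiv hG hA hAB⟩

/-- [OURS · K3.4] The same for a focus living on a sub-ambient: if `G` on `Y` is escaped by an LSB `B` that some `A`
over `Z[t]` induces, then every AR-extension `F` of `G` to `Z` (`F ⇌_Y G`: Lem. 3.14's «natural AR-extension», or any
`G′` of Lem. 15.3) is escaped by `A`. -/
theorem arExtension_inherits_escape {Y : Closeds Z} (G : IdealExponent (vanishingIdeal Y).subscheme)
    {t : Type u} {A : LSB 𝔸(t; Z)} {B : LSB 𝔸(t; (vanishingIdeal Y).subscheme)}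
    (hAB : LSBInduces (AffineSpace.map t (vanishingIdeal Y).subschemeι) A B) (hB : ¬ InS G t B)
    (F : IdealExponent Z) (hF : AREquiv F Y G) : ¬ InS F t A :=
  fun hA => hB ((inS_iff_of_arEquiv hF hAB).1 hA)

end Renewal

end Summit.ResolutionOfSingularities.ResolutionOfSingularities.Theorems.CampaignW34

end
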